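import Mathlib

/-!
# B3Characters — kernel forms of the character bookkeeping of T4-B3 §B2(d) and §B4(b.1)

Sub-claim B3 of the Tier-4 identification (pub-hodge-repro2, README §6.1(a)) builds, from an
anticyclotomic character `ν` of odd order, the automorphic character `χ = ν̃` of the norm-one
group through the map `j(x) = x / c(x)` (§B2(d)(i)–(iii)), and uses in §B4(b.1) that two
continuous characters agreeing on a dense subgroup coincide.  This file records the purely
group-theoretic / topological statements behind those steps, for an arbitrary commutative group
`A` with an involutive automorphism `c` (the adelic group `A_E^×` with complex conjugation) and an
arbitrary commutative target `M` (the values of `ν`):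

* `jHom c` is the homomorphism `x ↦ x * (c x)⁻¹`; its kernel is the set of `c`-fixed points
  (`mem_ker_jHom_iff`), and its image lies in the norm-one subgroup `{y | y * c y = 1}`
  (`jHom_mem_normOne`).
* an anticyclotomic character (`IsAnticyclotomic c ν`: `ν (c x) = (ν x)⁻¹`) of odd exponent is
  trivial on the `c`-fixed points (`IsAnticyclotomic.map_eq_one_of_fixed`), hence on `ker (jHom c)`
  (`IsAnticyclotomic.ker_jHom_le_ker`), and descends uniquely along `jHom c` to a character of
  its range (`IsAnticyclotomic.descend`, `descend_apply`, `descend_unique`) — this is the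
  definition `ν̃(j(x)) := ν(x)` of §B2(d)(iii) and its well-definedness.
* a homomorphism of topological groups that is trivial on a neighbourhood of `1` is continuous
  (`continuous_of_eventually_eq_one`) — the continuity step of §B2(d)(iii).
* a continuous homomorphism from a preconnected group to a discrete group is trivial
  (`map_eq_one_of_preconnectedSpace`) — the archimedean step of §B2(d)(i).
* two continuous homomorphisms agreeing on a dense subgroup are equal
  (`eq_of_eqOn_dense_subgroup`) — the last step of §B4(b.1).

No adelic object is formalised here: the surjectivity of `j` onto the norm-one group
(Hilbert 90, adelically) and the automorphic characters themselves remain prose in the section.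
-/

namespace Summit.Ventures.HodgeRepro2.ShimuraData.B3Characters

section Algebra

variable {A M : Type*} [CommGroup A] [CommGroup M]

/-- The homomorphism `j(x) = x * (c x)⁻¹` attached to an automorphism `c` of a commutative group
(for `A = A_E^×` and `c` = complex conjugation this is Liu's `x ↦ x / x^c`, T4-B3 §B2(d)(ii)). -/
def jHom (c : A ≃* A) : A →* A where
  toFun x := x * (c x)⁻¹
  map_one' := by simp
  map_mul' x y := by
    simp only [map_mul, mul_inv]
    exact mul_mul_mul_comm x y (c x)⁻¹ (c y)⁻¹

/-- `j(x) = x * (c x)⁻¹`, by definition. -/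
@[simp] theorem jHom_apply (c : A ≃* A) (x : A) : jHom c x = x * (c x)⁻¹ := rfl

/-- The kernel of `j` is the set of `c`-fixed points (T4-B3 §B2(d)(ii), «Kernel»). -/
theorem mem_ker_jHom_iff (c : A ≃* A) (x : A) : x ∈ (jHom c).ker ↔ c x = x := by
  rw [MonoidHom.mem_ker, jHom_apply, mul_inv_eq_one]
  exact eq_comm

/-- The norm-one subgroup `{y | y * c y = 1}` of an automorphism `c` of a commutative group
(Liu's `E^1(A) = {y ∈ A_E^× : y y^c = 1}`, `c` = complex conjugation). -/
def normOne (c : A ≃* A) : Subgroup A where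
  carrier := {y | y * c y = 1}
  one_mem' := by simp
  mul_mem' {a b} ha hb := by
    simp only [Set.mem_setOf_eq, map_mul] at ha hb ⊢
    calc a * b * (c a * c b) = (a * c a) * (b * c b) := by
          exact mul_mul_mul_comm a b (c a) (c b)
      _ = 1 := by rw [ha, hb, one_mul]
  inv_mem' {a} ha := by
    simp only [Set.mem_setOf_eq, map_inv] at ha ⊢
    rw [← mul_inv, ha, inv_one]

/-- Membership in the norm-one subgroup, by definition. -/
theorem mem_normOne_iff (c : A ≃* A) (y : A) : y ∈ normOne c ↔ y * c y = 1 := Iff.rfl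

/-- The image of `j` lies in the norm-one subgroup (T4-B3 §B2(d)(ii)). -/
theorem jHom_mem_normOne (c : A ≃* A) (hc : ∀ x, c (c x) = x) (x : A) :
    jHom c x ∈ normOne c := by
  rw [mem_normOne_iff, jHom_apply, map_mul, map_inv, hc, mul_assoc, ← mul_assoc (c x)⁻¹,
    inv_mul_cancel, one_mul, mul_inv_cancel]

/-- A character `ν : A →* M` is anticyclotomic for `c` if `ν (c x) = (ν x)⁻¹` for every `x`
(T4-B3 §B2(d), DEFINITION: `ν(cσc⁻¹) = ν(σ)⁻¹`, transported to `A_E^×` through the norm residue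
symbol). -/
def IsAnticyclotomic (c : A ≃* A) (ν : A →* M) : Prop := ∀ x, ν (c x) = (ν x)⁻¹

/-- In a commutative group, an element whose square is `1` and whose `n`-th power is `1` for an
odd `n` is `1` (the «odd order» step of T4-B3 §B2(d)(i)). -/
theorem eq_one_of_sq_eq_one_of_odd {m : M} {n : ℕ} (hn : Odd n) (h2 : m ^ 2 = 1)
    (hm : m ^ n = 1) : m = 1 := by
  obtain ⟨k, rfl⟩ := hn
  rw [pow_add, pow_mul, h2, one_pow, one_mul, pow_one] at hm
  exact hm

namespace IsAnticyclotomic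

variable {c : A ≃* A} {ν : A →* M}

/-- An anticyclotomic character with `ν x ^ n = 1` for all `x` and an odd `n` is trivial on the
`c`-fixed points (T4-B3 §B2(d)(i): `ν(rec_E(x))² = 1` and odd order force `ν(rec_E(x)) = 1`
for `x ∈ A_F^×`). -/
theorem map_eq_one_of_fixed (hν : IsAnticyclotomic c ν) {n : ℕ} (hn : Odd n)
    (hpow : ∀ x, ν x ^ n = 1) {x : A} (hx : c x = x) : ν x = 1 := by
  have h1 : ν x = (ν x)⁻¹ := by
    conv_lhs => rw [← hx]
    exact hν x
  have h2 : ν x ^ 2 = 1 := by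
    rw [pow_two]
    nth_rewrite 1 [h1]
    exact inv_mul_cancel (ν x)
  exact eq_one_of_sq_eq_one_of_odd hn h2 (hpow x)

/-- Hence `ker j ≤ ker ν`: `ν̃(j(x)) := ν(x)` is well defined (T4-B3 §B2(d)(iii)). -/
theorem ker_jHom_le_ker (hν : IsAnticyclotomic c ν) {n : ℕ} (hn : Odd n)
    (hpow : ∀ x, ν x ^ n = 1) : (jHom c).ker ≤ ν.ker := by
  intro x hx
  rw [mem_ker_jHom_iff] at hx
  rw [MonoidHom.mem_ker]
  exact hν.map_eq_one_of_fixed hn hpow hx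

/-- The descended character `ν̃ : range j →* M` (T4-B3 §B2(d)(iii)), obtained from the
factorisation of `ν` through `A ⧸ ker j ≃ range j`. -/
noncomputable def descend (hν : IsAnticyclotomic c ν) {n : ℕ} (hn : Odd n)
    (hpow : ∀ x, ν x ^ n = 1) : (jHom c).range →* M :=
  (QuotientGroup.lift (jHom c).ker ν (hν.ker_jHom_le_ker hn hpow)).comp
    (QuotientGroup.quotientKerEquivRange (jHom c)).symm.toMonoidHom

/-- `ν̃(j(x)) = ν(x)`. -/
theorem descend_apply (hν : IsAnticyclotomic c ν) {n : ℕ} (hn : Odd n)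
    (hpow : ∀ x, ν x ^ n = 1) (x : A) :
    hν.descend hn hpow ((jHom c).rangeRestrict x) = ν x := by
  unfold descend
  simp only [MonoidHom.coe_comp, MulEquiv.coe_toMonoidHom, Function.comp_apply]
  have h : (QuotientGroup.quotientKerEquivRange (jHom c)).symm ((jHom c).rangeRestrict x) =
      QuotientGroup.mk x := by
    rw [MulEquiv.symm_apply_eq]
    rfl
  rw [h]
  rfl

/-- Uniqueness: a character of `range j` agreeing with `ν` through `j` is the descended one. -/
theorem descend_unique (hν : IsAnticyclotomic c ν) {n : ℕ} (hn : Odd n)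
    (hpow : ∀ x, ν x ^ n = 1) (ν' : (jHom c).range →* M)
    (hν' : ∀ x, ν' ((jHom c).rangeRestrict x) = ν x) : ν' = hν.descend hn hpow := by
  ext ⟨y, hy⟩
  obtain ⟨x, rfl⟩ := hy
  have e : (⟨jHom c x, ⟨x, rfl⟩⟩ : (jHom c).range) = (jHom c).rangeRestrict x := rfl
  rw [e, hν' x, hν.descend_apply hn hpow x]

end IsAnticyclotomic

end Algebra

section Topology

variable {A M : Type*} [Group A] [TopologicalSpace A] [Group M] [TopologicalSpace M]

/-- A homomorphism of topological groups that is `1` on a neighbourhood of `1` is continuous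
(T4-B3 §B2(d)(iii): `ν̃ = 1` on `j(U)`, a neighbourhood of `1`, hence `ν̃` is continuous). -/
theorem continuous_of_eventually_eq_one [IsTopologicalGroup A] [ContinuousMul M] (f : A →* M)
    (h : ∀ᶠ u in nhds (1 : A), f u = 1) : Continuous f := by
  refine continuous_of_continuousAt_one f ?_
  unfold ContinuousAt
  rw [map_one]
  exact tendsto_const_nhds.congr' (h.mono fun u hu => hu.symm)

/-- A continuous homomorphism from a preconnected topological group to a discrete group is
trivial (T4-B3 §B2(d)(i): `ν ∘ rec_E` is trivial on the connected group `E_∞^×`). -/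
theorem map_eq_one_of_preconnectedSpace [PreconnectedSpace A] {N : Type*} [Group N]
    [TopologicalSpace N] [DiscreteTopology N] (f : A →* N) (hf : Continuous f) (x : A) :
    f x = 1 := by
  rw [← map_one f]
  exact PreconnectedSpace.constant inferInstance hf

/-- Two continuous homomorphisms into a Hausdorff group that agree on a dense subgroup are equal
(T4-B3 §B4(b.1): `μ' μ⁻¹` trivial on the dense subgroup `E^× (A_E^∞)^×` forces `μ = μ'`). -/
theorem eq_of_eqOn_dense_subgroup [T2Space M] {f g : A →* M} (hf : Continuous f)
    (hg : Continuous g) (H : Subgroup A) (hH : Dense (H : Set A))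
    (h : ∀ x ∈ H, f x = g x) : f = g :=
  DFunLike.coe_injective (Continuous.ext_on hH hf hg fun x hx => h x hx)

end Topology

end Summit.Ventures.HodgeRepro2.ShimuraData.B3Characters
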